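import Summits.FinalStateConjecture.FinalStateConjecture.Theses.PhaseMixingCapture
import Literature.Geometry.Lorentzian.StabilityCauchy
import Literature.Geometry.Lorentzian.CauchyProblemMGHDExistence

/-!
# `BulkKerrCapture` (stmt-FinalStateConjecture-10696, route PhaseMixingCapture) — negative-side
# lemmas I: the strict spin gap `a₁ < 1` and the positivity `0 < M` are load-bearing

Refuter seat `refuter-cdisprove-stmt-FinalStateConjecture-10696-0` (standing disprover of the crux),
2026-08-16; workfile `Cruxes/BulkKerrCapture/Disproof.lean`. Nothing here closes the item; these are
the kernel-checked NEGATIVE LEMMAS of the disproof attempt (cdisprove protocol (a)–(c)):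

* `CaptureAt` — the conclusion block of the crux with its parameters `(s, δ, k, M, ε, C, a)` exposed,
  and `bulkKerrCapture_iff : BulkKerrCapture ↔ ∀ … CaptureAt …` (the route decl's inlined sojourn
  clause is `DataEmbedding.HasCompleteFutureNullInfinityFar` after `range_farSliceIncl`).
* `no_spin_of_neg`, `isSubextremal_of_spin_le`, `bulkKerrCapture_iff_nonneg` — the spin range
  `|a| ≤ a₁ M` is empty for `a₁ < 0` and sub-extremal for `a₁ < 1`; WLOG `0 ≤ a₁`.
* `captureAt_atKerrData`, `bulkKerrCapture_atKerrData` — at the centre of the data ball (exact Kerr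
  data, distance `0`) the modulus `C √dist` pins `(M', a') = (M, a)`: the crux contains the sanity
  statement "every MGHD of `Kerr.data M a M` is far-complete and converges to `g_{M,a}`" (expected
  true; the two named facts about the Kerr data enter as hypotheses, as in
  `klainerman_szeftel_kerr_stability_small_a_cauchy.atKerrData`).
* `BulkCaptureFamily T P` — the crux with its two side conditions exposed (thresholds `a₁ ∈ T`,
  masses `0 ≤ M ∧ P M`; a parametrised predicate, not a named fact); the crux is the member
  `(Iio 1, (0 < ·))` (`bulkKerrCapture_iff_family`), the family is antitone (`BulkCaptureFamily.anti`),
  so the closed-range member `(Iic 1, (0 < ·))` (`a₁ ≤ 1`) and the `0 ≤ M` member `(Iio 1, ⊤)` are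
  strengthenings (`bulkKerrCapture_of_closedRange`, `bulkKerrCapture_of_nonnegMass`) — and each is
  FALSE in every instance world where the tree's named facts hold
  (`bulkCaptureFamily_false_without_spinGap`: extremal Kerr data `a = M` would need a sub-extremal
  final state at parameter distance `0`; `bulkCaptureFamily_false_without_posMass`: the flat
  punctured data `Kerr.data 0 0 0` would need `|a'| < M' = 0`; both packaged in
  `strengthenings_fail`). The named facts used as hypotheses: Levi-Civita existence for the Kerr
  data metric, `Kerr.data_isVacuumConstraintSolution`, `choquetBruhat_geroch_exists_mghd_cauchy`
  (packaged as `exists_mghd_kerrData`), under the instance hypotheses `[Kerr.Facts]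
  [Kerr.SliceFacts]`. So every proof of the crux must use both `a₁ < 1` and `0 < M`, and it must
  use them already for exact Kerr data.

## References

* Y. Choquet-Bruhat, R. Geroch, Comm. Math. Phys. 14 (1969) 329–335, Thm. 3 (MGHD existence).
* S. Klainerman, J. Szeftel, Pure Appl. Math. Q. 19 (2023), Thm. 1.2.1, (3.4.7)–(3.4.8) (modulus).
* S. Aretakis, Adv. Theor. Math. Phys. 19 (2015) 507–530 (why `|a| = M` is excluded physically;
  the formal exclusion here is the modulus alone).
-/

noncomputable section

open Set
open scoped Manifold ENNReal ContDiff

namespace Summit.FinalStateConjecture.FinalStateConjecture.Theorems.BulkKerrCapture.Negative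

open Literature.Geometry.Lorentzian
open Summit.FinalStateConjecture.FinalStateConjecture.Theses.PhaseMixingCapture (BulkKerrCapture)

/-! ## §1 The conclusion block with parameters exposed -/

/-- `CaptureAt s δ k M hM ε C a`: every vacuum-constraint solution `D` on `Kerr.slice a M` within
`H^s_δ`-distance `ε` of `Kerr.data M a M` has all its maximal vacuum Cauchy developments
far-complete (`DataEmbedding.HasCompleteFutureNullInfinityFar`), with a region converging in `Cᵏ`
to a sub-extremal `g_{M',a'}` and `|M' − M| + |a' − a| ≤ C √dist`. This is the matrix of the crux
(and of `Literature.Barriers.FinalStateConjecture.KerrStabilityHoldsBelowNarrow` at `r₀ = M`).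
[folklore] -/
def CaptureAt [Kerr.Facts] [Kerr.SliceFacts] (s : ℕ) (δ : ℝ) (k : ℕ) (M : ℝ) (hM : 0 ≤ M)
    (ε C a : ℝ) : Prop :=
  ∀ (D : InitialDataSet 𝓘(ℝ, E3) (Kerr.slice a M)) [D.metric.HasLeviCivita],
    D.IsVacuumConstraintSolution →
    InitialDataSet.dataWeightedSobolevEDist s δ D (Kerr.data M a M hM) < ENNReal.ofReal ε →
    ∀ 𝒟 : VacuumCauchyDevelopment D, 𝒟.IsMaximal →
      ∃ (M' a' : ℝ) (𝒟oc : Set 𝒟.carrier), Kerr.IsSubextremal M' a' ∧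
        𝒟.HasCompleteFutureNullInfinityFar ∧
        𝒟.toSpacetime.ConvergesToKerr 𝒟oc M' a' k ∧
        |M' - M| + |a' - a| ≤
          C * √(InitialDataSet.dataWeightedSobolevEDist s δ D (Kerr.data M a M hM)).toReal

/-- The closed far region of the slice, as a subset of the slice, is `{q | R + 1 ≤ ‖q‖}`
(`R = Kerr.afRadius a r₀`). [folklore] -/
theorem range_farSliceIncl (a r₀ : ℝ) :
    range (Kerr.farSliceIncl a r₀) = {q : Kerr.slice a r₀ | Kerr.afRadius a r₀ + 1 ≤ ‖(q : E3)‖} := by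
  ext q
  constructor
  · rintro ⟨y, rfl⟩
    exact y.2
  · intro hq
    exact ⟨⟨(q : E3), hq⟩, Subtype.ext rfl⟩

/-- **The crux in `CaptureAt` form.** The inlined sojourn clause of the route decl is, after
`range_farSliceIncl`, literally `DataEmbedding.HasCompleteFutureNullInfinityFar` (this re-certifies
the planner's `bulk_iff`). [folklore] -/
theorem bulkKerrCapture_iff :
    BulkKerrCapture ↔
      ∀ [Kerr.Facts] [Kerr.SliceFacts], ∀ a₁ : ℝ, a₁ < 1 → ∃ (s : ℕ) (δ : ℝ) (k : ℕ),
        ∀ (M : ℝ) (hM : 0 < M), ∃ ε > (0 : ℝ), ∃ C : ℝ, ∀ a : ℝ, |a| ≤ a₁ * M →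
          CaptureAt s δ k M hM.le ε C a := by
  simp only [BulkKerrCapture, CaptureAt, DataEmbedding.HasCompleteFutureNullInfinityFar,
    DataEmbedding.HasCompleteFutureNullInfinityFrom, range_farSliceIncl]

/-! ## §2 Structure of the quantifier prefix (prover-usable) -/

/-- For `a₁ < 0` the spin range `|a| ≤ a₁ M` (`M > 0`) is EMPTY: the crux is only about
`a₁ ∈ [0, 1)`. [folklore] -/
theorem no_spin_of_neg {a₁ M a : ℝ} (ha₁ : a₁ < 0) (hM : 0 < M) : ¬ |a| ≤ a₁ * M := by
  intro h
  have : a₁ * M < 0 := mul_neg_of_neg_of_pos ha₁ hM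
  linarith [abs_nonneg a]

/-- Every spin in the range is sub-extremal: `|a| ≤ a₁ M < M`. [folklore] -/
theorem isSubextremal_of_spin_le {a₁ M a : ℝ} (ha₁ : a₁ < 1) (hM : 0 < M) (h : |a| ≤ a₁ * M) :
    Kerr.IsSubextremal M a := by
  unfold Kerr.IsSubextremal
  have : a₁ * M < 1 * M := mul_lt_mul_of_pos_right ha₁ hM
  linarith

/-- WLOG `0 ≤ a₁`: the crux is equivalent to its restriction to `a₁ ∈ [0, 1)` (for `a₁ < 0` take
the witnesses `(0, 0, 0, 1, 0)`; the spin hypothesis is then unsatisfiable). [folklore] -/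
theorem bulkKerrCapture_iff_nonneg :
    BulkKerrCapture ↔
      ∀ [Kerr.Facts] [Kerr.SliceFacts], ∀ a₁ : ℝ, 0 ≤ a₁ → a₁ < 1 → ∃ (s : ℕ) (δ : ℝ) (k : ℕ),
        ∀ (M : ℝ) (hM : 0 < M), ∃ ε > (0 : ℝ), ∃ C : ℝ, ∀ a : ℝ, |a| ≤ a₁ * M →
          CaptureAt s δ k M hM.le ε C a := by
  rw [bulkKerrCapture_iff]
  constructor
  · intro h _ _ a₁ _ ha₁
    exact h a₁ ha₁
  · intro h _ _ a₁ ha₁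
    rcases le_or_gt 0 a₁ with h0 | h0
    · exact h a₁ h0 ha₁
    · exact ⟨0, 0, 0, fun M hM ↦ ⟨1, one_pos, 0, fun a ha ↦ (no_spin_of_neg h0 hM ha).elim⟩⟩

/-- **Centre of the ball.** `CaptureAt … a` applied to the exact Kerr data (distance `0`) pins the
final parameters to `(M, a)` and yields: every MGHD of `Kerr.data M a M` is far-complete and has a
region converging in `Cᵏ` to `g_{M,a}` itself. The two named facts about the Kerr data enter as
hypotheses (`hLC`: Levi-Civita of `h`; `hvac`: the vacuum constraints), exactly as in
`klainerman_szeftel_kerr_stability_small_a_cauchy.atKerrData`. This is the cheapest necessary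
condition of the crux; it is the expected-true sanity statement (outgoing rays complete, far
infalling rays die on the Cauchy horizon of the inner edge only after affine time `≳` their origin
radius; the exterior `{t* ≥ 0, r ≥ r₊}` lies in `D⁺` of the slice), so it offers no refutation.
[folklore] -/
theorem captureAt_atKerrData [Kerr.Facts] [Kerr.SliceFacts] {s : ℕ} {δ : ℝ} {k : ℕ} {M : ℝ}
    {hM : 0 ≤ M} {ε C a : ℝ} (hε : 0 < ε) (h : CaptureAt s δ k M hM ε C a)
    (hLC : (Kerr.data M a M hM).metric.isCovariantDerivativeOn_leviCivitaFun)
    (hvac : Kerr.data_isVacuumConstraintSolution M a M)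
    (𝒟 : VacuumCauchyDevelopment (Kerr.data M a M hM)) (hmax : 𝒟.IsMaximal) :
    𝒟.HasCompleteFutureNullInfinityFar ∧
      ∃ 𝒟oc : Set 𝒟.carrier, 𝒟.toSpacetime.ConvergesToKerr 𝒟oc M a k := by
  haveI := PseudoRiemannianMetric.HasLeviCivita.of _ hLC
  have h0 : InitialDataSet.dataWeightedSobolevEDist s δ (Kerr.data M a M hM)
      (Kerr.data M a M hM) < ENNReal.ofReal ε := by
    rw [InitialDataSet.dataWeightedSobolevEDist_self]
    exact ENNReal.ofReal_pos.2 hε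
  obtain ⟨M', a', 𝒟oc, -, hnull, hconv, hpar⟩ := h _ (hvac hM) h0 𝒟 hmax
  rw [InitialDataSet.dataWeightedSobolevEDist_self, ENNReal.toReal_zero, Real.sqrt_zero,
    mul_zero] at hpar
  have hM' : M' = M := by
    refine sub_eq_zero.1 (abs_eq_zero.1 (le_antisymm ?_ (abs_nonneg _)))
    linarith [abs_nonneg (a' - a)]
  have ha' : a' = a := by
    refine sub_eq_zero.1 (abs_eq_zero.1 (le_antisymm ?_ (abs_nonneg _)))
    linarith [abs_nonneg (M' - M)]
  subst hM' ha'
  exact ⟨hnull, 𝒟oc, hconv⟩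

/-- **The crux at the centre of its ball**: `BulkKerrCapture` implies that for every `M > 0` and
every sub-extremal spin `|a| < M` (take `a₁ := |a|/M`) every MGHD of the exact Kerr data on
`{t* = 0, r > M}` is far-complete and converges in some `Cᵏ` to `g_{M,a}`. [folklore] -/
theorem bulkKerrCapture_atKerrData (h : BulkKerrCapture) [Kerr.Facts] [Kerr.SliceFacts]
    (hLC : ∀ (M a r₀ : ℝ) (hM : 0 ≤ M),
      (Kerr.data M a r₀ hM).metric.isCovariantDerivativeOn_leviCivitaFun)
    (hvac : ∀ (M a r₀ : ℝ), Kerr.data_isVacuumConstraintSolution M a r₀)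
    {M a : ℝ} (hM : 0 < M) (ha : Kerr.IsSubextremal M a) :
    ∃ k : ℕ, ∀ 𝒟 : VacuumCauchyDevelopment (Kerr.data M a M hM.le), 𝒟.IsMaximal →
      𝒟.HasCompleteFutureNullInfinityFar ∧
        ∃ 𝒟oc : Set 𝒟.carrier, 𝒟.toSpacetime.ConvergesToKerr 𝒟oc M a k := by
  rw [bulkKerrCapture_iff] at h
  have ha₁ : |a| / M < 1 := by
    rw [div_lt_one hM]
    exact ha
  obtain ⟨s, δ, k, hk⟩ := h (|a| / M) ha₁
  obtain ⟨ε, hε, C, hC⟩ := hk M hM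
  have hspin : |a| ≤ |a| / M * M := by rw [div_mul_cancel₀ _ hM.ne']
  exact ⟨k, fun 𝒟 hmax ↦ captureAt_atKerrData hε (hC a hspin) (hLC M a M hM.le) (hvac M a M) 𝒟 hmax⟩

/-! ## §3 Load-bearing hypotheses: negative lemmas modulo the tree's named facts

Each weakened member of `BulkCaptureFamily` below is the crux with ONE side condition weakened;
each `_false_without_` theorem refutes it from the named facts `Kerr.Facts`, `Kerr.SliceFacts`, Levi-Civita existence for
the Kerr data metric, `Kerr.data_isVacuumConstraintSolution` and Choquet-Bruhat–Geroch MGHD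
existence (`choquetBruhat_geroch_exists_mghd_cauchy`) — all theorems in print, none constructible
in the tree today, which is exactly why these are negative lemmas and not refutations. -/

/-- An MGHD of the Kerr data exists, from the named facts (CBG 1969 Thm. 3 applied to
`Kerr.data M a r₀`; the slice is Hausdorff and second countable as an open subset of `E3`,
connected by `Kerr.SliceFacts`). [cite: ChoquetBruhatGeroch1969CMP, Thm. 3 (p. 332)] -/
theorem exists_mghd_kerrData [Kerr.Facts] [Kerr.SliceFacts]
    (hLC : ∀ (M a r₀ : ℝ) (hM : 0 ≤ M),
      (Kerr.data M a r₀ hM).metric.isCovariantDerivativeOn_leviCivitaFun)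
    (hvac : ∀ (M a r₀ : ℝ), Kerr.data_isVacuumConstraintSolution M a r₀)
    (hMGHD : choquetBruhat_geroch_exists_mghd_cauchy) (M a r₀ : ℝ) (hM : 0 ≤ M) :
    ∃ 𝒟 : VacuumCauchyDevelopment (Kerr.data M a r₀ hM), 𝒟.IsMaximal := by
  haveI := PseudoRiemannianMetric.HasLeviCivita.of _ (hLC M a r₀ hM)
  exact hMGHD (Kerr.slice a r₀) (Kerr.data M a r₀ hM) (hvac M a r₀ hM)

/-- **The crux family with its two side conditions exposed**: spin thresholds `a₁` range over
`T ⊆ ℝ` and masses over `{M | 0 ≤ M ∧ P M}`; everything else verbatim (`CaptureAt`). The crux is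
the member `T = Iio 1`, `P = (0 < ·)` (`bulkKerrCapture_iff_family`); the two one-hypothesis
weakenings studied below are `T = Iic 1` (closed spin range, (A)) and `P = ⊤` (`0 ≤ M`, (B)).
A parametrised predicate, not a named fact. [folklore] -/
def BulkCaptureFamily [Kerr.Facts] [Kerr.SliceFacts] (T : Set ℝ) (P : ℝ → Prop) : Prop :=
  ∀ a₁ ∈ T, ∃ (s : ℕ) (δ : ℝ) (k : ℕ), ∀ (M : ℝ) (hM : 0 ≤ M), P M → ∃ ε > (0 : ℝ), ∃ C : ℝ,
    ∀ a : ℝ, |a| ≤ a₁ * M → CaptureAt s δ k M hM ε C a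

/-- The family is antitone in the threshold set and in the mass predicate: enlarging `T` or `P`
strengthens the statement. [folklore] -/
theorem BulkCaptureFamily.anti [Kerr.Facts] [Kerr.SliceFacts] {T T' : Set ℝ} {P P' : ℝ → Prop}
    (h : BulkCaptureFamily T P) (hT : T' ⊆ T) (hP : ∀ M, P' M → P M) :
    BulkCaptureFamily T' P' := by
  intro a₁ ha₁
  obtain ⟨s, δ, k, hk⟩ := h a₁ (hT ha₁)
  exact ⟨s, δ, k, fun M hM hPM ↦ hk M hM (hP M hPM)⟩

/-- **The crux is the member `T = Iio 1`, `P = (0 < ·)` of the family.** [folklore] -/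
theorem bulkKerrCapture_iff_family :
    BulkKerrCapture ↔
      ∀ [Kerr.Facts] [Kerr.SliceFacts], BulkCaptureFamily (Iio 1) (fun M ↦ 0 < M) := by
  rw [bulkKerrCapture_iff]
  constructor
  · intro h _ _ a₁ ha₁
    obtain ⟨s, δ, k, hk⟩ := h a₁ ha₁
    exact ⟨s, δ, k, fun M _ hM ↦ hk M hM⟩
  · intro h _ _ a₁ ha₁
    obtain ⟨s, δ, k, hk⟩ := h a₁ ha₁
    exact ⟨s, δ, k, fun M hM ↦ hk M hM.le hM⟩

/-- (A) The closed-range member (`a₁ ≤ 1`, i.e. spins `|a| ≤ M` including extremality) implies the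
crux: it is a strengthening. [folklore] -/
theorem bulkKerrCapture_of_closedRange
    (h : ∀ [Kerr.Facts] [Kerr.SliceFacts], BulkCaptureFamily (Iic 1) (fun M ↦ 0 < M)) :
    BulkKerrCapture :=
  bulkKerrCapture_iff_family.2 (h.anti Iio_subset_Iic_self fun _ hM ↦ hM)

/-- (B) The `0 ≤ M` member (`P = ⊤`) implies the crux: it is a strengthening. [folklore] -/
theorem bulkKerrCapture_of_nonnegMass
    (h : ∀ [Kerr.Facts] [Kerr.SliceFacts], BulkCaptureFamily (Iio 1) fun _ ↦ True) :
    BulkKerrCapture :=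
  bulkKerrCapture_iff_family.2 (h.anti subset_rfl fun _ _ ↦ trivial)

/-- **(A) `a₁ < 1` is load-bearing (any proof must use the strict spin gap), already at the centre
of the ball.** In any instance world where the named facts hold, the closed-range member is FALSE:
at `a₁ = 1`, `M = 1`, `a = 1` the exact extremal Kerr data `Kerr.data 1 1 1` lie in every ball
around themselves, an MGHD exists (CBG), and the conclusion demands sub-extremal `(M', a')` with
`|M' − 1| + |a' − 1| ≤ C · √0 = 0`, i.e. `(M', a') = (1, 1)`, which is not sub-extremal. (The
physics agrees for a different reason — Aretakis, `Literature.Barriers.FinalStateConjecture.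
ExtremalHorizonInstability` — but the formal kill is the modulus alone.) [folklore] -/
theorem bulkCaptureFamily_false_without_spinGap [Kerr.Facts] [Kerr.SliceFacts]
    (hLC : ∀ (M a r₀ : ℝ) (hM : 0 ≤ M),
      (Kerr.data M a r₀ hM).metric.isCovariantDerivativeOn_leviCivitaFun)
    (hvac : ∀ (M a r₀ : ℝ), Kerr.data_isVacuumConstraintSolution M a r₀)
    (hMGHD : choquetBruhat_geroch_exists_mghd_cauchy) :
    ¬ BulkCaptureFamily (Iic 1) (fun M ↦ 0 < M) := by
  intro h
  obtain ⟨s, δ, k, hk⟩ := h 1 (Set.mem_Iic.2 le_rfl)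
  obtain ⟨ε, hε, C, hC⟩ := hk 1 zero_le_one one_pos
  have hspin : |(1 : ℝ)| ≤ 1 * 1 := by norm_num
  have hcap := hC 1 hspin
  obtain ⟨𝒟, hmax⟩ := exists_mghd_kerrData hLC hvac hMGHD 1 1 1 zero_le_one
  haveI := PseudoRiemannianMetric.HasLeviCivita.of _ (hLC 1 1 1 zero_le_one)
  have h0 : InitialDataSet.dataWeightedSobolevEDist s δ (Kerr.data 1 1 1 zero_le_one)
      (Kerr.data 1 1 1 zero_le_one) < ENNReal.ofReal ε := by
    rw [InitialDataSet.dataWeightedSobolevEDist_self]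
    exact ENNReal.ofReal_pos.2 hε
  obtain ⟨M', a', -, hsub, -, -, hpar⟩ := hcap _ (hvac 1 1 1 zero_le_one) h0 𝒟 hmax
  rw [InitialDataSet.dataWeightedSobolevEDist_self, ENNReal.toReal_zero, Real.sqrt_zero,
    mul_zero] at hpar
  unfold Kerr.IsSubextremal at hsub
  have h1 : |M' - 1| ≤ 0 := by linarith [abs_nonneg (a' - 1)]
  have h2 : |a' - 1| ≤ 0 := by linarith [abs_nonneg (M' - 1)]
  have hM' : M' = 1 := by linarith [abs_le.1 h1]
  have ha' : a' = 1 := by linarith [abs_le.1 h2]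
  subst hM' ha'
  norm_num at hsub

/-- **(B) `0 < M` is load-bearing.** In any instance world where the named facts hold, the `0 ≤ M`
member is FALSE: at `a₁ = 0`, `M = 0`, `a = 0` the flat punctured data `Kerr.data 0 0 0` lie in
every ball around themselves, an MGHD exists (CBG), and the conclusion demands `(M', a')`
sub-extremal with `|M'| + |a'| ≤ C · √0 = 0`, i.e. `M' = 0`, `|a'| < 0`. (Geometrically the MGHD of
flat data on `ℝ³ ∖ {0}` is `{|t| < |x⃗|} ⊂ ℝ^{1,3}`, which is indeed NOT far-complete — infalling
radial rays from radius `R` die at affine time `R/2` with sojourn `≈ R₀/2` — but the formal kill is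
again the modulus.) [folklore] -/
theorem bulkCaptureFamily_false_without_posMass [Kerr.Facts] [Kerr.SliceFacts]
    (hLC : ∀ (M a r₀ : ℝ) (hM : 0 ≤ M),
      (Kerr.data M a r₀ hM).metric.isCovariantDerivativeOn_leviCivitaFun)
    (hvac : ∀ (M a r₀ : ℝ), Kerr.data_isVacuumConstraintSolution M a r₀)
    (hMGHD : choquetBruhat_geroch_exists_mghd_cauchy) :
    ¬ BulkCaptureFamily (Iio 1) (fun _ ↦ True) := by
  intro h
  obtain ⟨s, δ, k, hk⟩ := h 0 (by norm_num)
  obtain ⟨ε, hε, C, hC⟩ := hk 0 le_rfl trivial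
  have hspin : |(0 : ℝ)| ≤ 0 * 0 := by norm_num
  have hcap := hC 0 hspin
  obtain ⟨𝒟, hmax⟩ := exists_mghd_kerrData hLC hvac hMGHD 0 0 0 le_rfl
  haveI := PseudoRiemannianMetric.HasLeviCivita.of _ (hLC 0 0 0 le_rfl)
  have h0 : InitialDataSet.dataWeightedSobolevEDist s δ (Kerr.data 0 0 0 le_rfl)
      (Kerr.data 0 0 0 le_rfl) < ENNReal.ofReal ε := by
    rw [InitialDataSet.dataWeightedSobolevEDist_self]
    exact ENNReal.ofReal_pos.2 hε
  obtain ⟨M', a', -, hsub, -, -, hpar⟩ := hcap _ (hvac 0 0 0 le_rfl) h0 𝒟 hmax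
  rw [InitialDataSet.dataWeightedSobolevEDist_self, ENNReal.toReal_zero, Real.sqrt_zero,
    mul_zero] at hpar
  unfold Kerr.IsSubextremal at hsub
  have h1 : |M' - 0| ≤ 0 := by linarith [abs_nonneg (a' - 0)]
  have hM' : M' = 0 := by linarith [abs_le.1 h1]
  subst hM'
  linarith [abs_nonneg a']

/-- **The two negative lemmas against the crux's own world.** If the crux holds together with the
named facts, then neither one-hypothesis weakening does: the spin gap and the positivity of the
mass are each used essentially. [folklore] -/
theorem strengthenings_fail [Kerr.Facts] [Kerr.SliceFacts]
    (hLC : ∀ (M a r₀ : ℝ) (hM : 0 ≤ M),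
      (Kerr.data M a r₀ hM).metric.isCovariantDerivativeOn_leviCivitaFun)
    (hvac : ∀ (M a r₀ : ℝ), Kerr.data_isVacuumConstraintSolution M a r₀)
    (hMGHD : choquetBruhat_geroch_exists_mghd_cauchy) :
    ¬ BulkCaptureFamily (Iic 1) (fun M ↦ 0 < M) ∧ ¬ BulkCaptureFamily (Iio 1) (fun _ ↦ True) :=
  ⟨bulkCaptureFamily_false_without_spinGap hLC hvac hMGHD,
    bulkCaptureFamily_false_without_posMass hLC hvac hMGHD⟩

end Summit.FinalStateConjecture.FinalStateConjecture.Theorems.BulkKerrCapture.Negative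

end
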